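import Mathlib
import Summits.RiemannHypothesis.RiemannHypothesis.Theorems.JensenPolynomialsDefs
import Literature.NumberTheory.LFunctions.XiMoments
import Literature.NumberTheory.LFunctions.XiTiltedPotential
import Literature.NumberTheory.LFunctions.XiGaussModeMap
import Literature.NumberTheory.LFunctions.DeBruijnPhiLogDerivEnvelope
import Literature.NumberTheory.LFunctions.DeBruijnPhiDecreasing
import Literature.NumberTheory.LFunctions.DeBruijnNewmanProofs
import Literature.NumberTheory.LFunctions.DeBruijnPhiLogConcaveSqrt

/-!
# Route `JensenPolynomials` — S-T5 `XiDeltaSqPos` (strict Turán inequalities of `ξ`'s Taylor data) REDUCED to the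
Csordas–Norfolk–Varga lemma, zero-free (RH-FREE proof-of-data; cell rh-jensen, HUMAN RULING D-0040)

The route's support item `XiDeltaSqPos` (`Δ(M)² > 0` for all `M ≥ 2`, i.e. `γ(M−1)² > γ(M−2)γ(M)` for
`γ = xiTaylorCoeff`) is the strict TURÁN INEQUALITY of the Taylor coefficients of `ξ` — a theorem in print
(Csordas–Norfolk–Varga 1986), in the tree so far only height-bought (`xiTaylorCoeff_mul_le_sq`, non-strict, from RH
to height `16`).  This file gives the ZERO-FREE kernel proof of everything in the Csordas–Norfolk–Varga argument
EXCEPT their analytic lemma on `Φ` near `0`, which is isolated as ONE named published fact: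

* `DeBruijnPhiLogConcaveSqrt` — `u ↦ −Φ′(u)/(uΦ(u))` is non-decreasing on `(0, ∞)` (⟺ `log Φ(√t)` concave,
  CNV 1986; Dimitrov–Lucas 2011, Thm. B); the tree already has it STRICTLY on `[1, ∞)`
  (`strictMonoOn_phiNegLogDeriv_div`, Coffey–Csordas' quantitative log-concavity);
* `xiMoment_turan_strict_of_monotoneOn` — **PROVED**: that monotonicity implies
  `(2k+1)·M_{2k}·M_{2k+4} < (2k+3)·M_{2k+2}²` for every `k` (`M_j = ∫₀^∞ Φ(u)u^j du`), by CHEBYSHEV'S COVARIANCE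
  INEQUALITY for the law `u^{2k+2}Φ(u)du` with the test functions `u²` and `g(u) = −Φ′(u)/(uΦ(u))`: pointwise
  `(u² − m²)(g(u) − g(m)) ≥ 0`, integrated with `m² = M_{2k+4}/M_{2k+2}`, and the integrations by parts
  `∫₀^∞ u^a Φ′ = −a M_{a−1}` (`integral_pow_mul_deBruijnPhiDeriv`; boundary terms vanish by the super-exponential
  decay of `Φ`); STRICT because `g` is strictly increasing beyond `max(m, 1)`;
* `xiTaylorCoeff_turan_strict_of_monotoneOn` — `γ(k)γ(k+2) < γ(k+1)²` (`γ(k) = 64·4^k·k!/(2k)!·M_{2k}`);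
* `strictMonoOn_phiNegLogDeriv_div_quarter` (UNCONDITIONAL: `L(u)/u` strictly increasing on `[1/4, ∞)`) and
  `xiDeltaSqPos_of_monotoneOn_small` / `_of_monotoneOn_logConcavity` — S-T5 from the monotonicity of
  `−Φ′/(uΦ)` on `(0, 1/4]`, resp. of `V = −(log Φ)″` on `[0, 1/4]`, ALONE (what remains of the item);
* `xiDeltaSqPos_of_logConcaveSqrt : Literature.NumberTheory.LFunctions.DeBruijnPhiLogConcaveSqrt → XiDeltaSqPos` — the conditional closer of the
  item (credits nothing until the lemma is discharged; the discharge needs the fourth-order behaviour of `log Φ` at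
  `0`, CNV §3–4 — not in the tree).

WHAT THIS IS NOT: nothing here bears on the zeros of `ζ` (Turán's inequalities are necessary, far from sufficient,
for RH); import closure zero-free (`XiMoments`, `XiTiltedPotential`, `XiGaussModeMap`, `DeBruijnPhi*`).

References: Csordas–Norfolk–Varga, Trans. AMS 296 (1986) 521–541 [CsordasNorfolkVarga1986]; Dimitrov–Lucas, Proc. AMS
139 (2011) 1013–1022, Thms. A, B [DimitrovLucas2011]; Coffey–Csordas, Math. Comp. 82 (2013), Thm. 2.4 [CoffeyCsordas2013].
-/

noncomputable section
-- D-0017: `Summit.RiemannHypothesis.RiemannHypothesis.…` duplicates the namespace BY DESIGN (single-problem summit).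
set_option linter.dupNamespace false

namespace Summit.RiemannHypothesis.RiemannHypothesis.Theorems.JensenPolynomials

open Literature.NumberTheory.LFunctions MeasureTheory Set Filter
open scoped Topology Nat

/-- `u ↦ u^a Φ′(u)` is integrable on `(0, ∞)` (`|Φ′| ≤ 4πe^{4u}Φ`, `u^a ≤ a!e^u`, and `Φe^{5u}` is integrable). -/
theorem integrableOn_pow_mul_deBruijnPhiDeriv (a : ℕ) :
    IntegrableOn (fun u : ℝ => u ^ a * deBruijnPhiDeriv u) (Ioi 0) := by
  have hdom : ∀ u ∈ Ioi (0 : ℝ), ‖u ^ a * deBruijnPhiDeriv u‖ ≤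
      4 * Real.pi * (a ! : ℝ) * deBruijnHBound 0 5 u := by
    intro u hu
    have hu0 : 0 < u := hu
    have hΦ : 0 < deBruijnPhi u := deBruijnPhi_pos_of_nonneg hu0.le
    have hneg : deBruijnPhiDeriv u < 0 := deBruijnPhiDeriv_neg_of_pos hu0
    have henv : -deBruijnPhiDeriv u ≤ (4 * Real.pi * Real.exp (4 * u) - 9) * deBruijnPhi u :=
      neg_deBruijnPhiDeriv_le hu0.le
    have hpow : u ^ a ≤ (a ! : ℝ) * Real.exp u := pow_le_factorial_mul_exp hu0.le a
    rw [Real.norm_eq_abs, abs_mul, abs_of_nonneg (pow_nonneg hu0.le a), abs_of_neg hneg]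
    unfold deBruijnHBound
    rw [zero_mul, Real.exp_zero, one_mul, abs_of_pos hΦ]
    calc u ^ a * -deBruijnPhiDeriv u
        ≤ ((a ! : ℝ) * Real.exp u) * ((4 * Real.pi * Real.exp (4 * u) - 9) * deBruijnPhi u) :=
          mul_le_mul hpow henv (by linarith) (by positivity)
      _ ≤ ((a ! : ℝ) * Real.exp u) * ((4 * Real.pi * Real.exp (4 * u)) * deBruijnPhi u) := by
          gcongr; linarith
      _ = 4 * Real.pi * (a ! : ℝ) * (deBruijnPhi u * Real.exp (5 * u)) := by
          rw [show (5 : ℝ) * u = u + 4 * u by ring, Real.exp_add]; ring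
  exact (((integrableOn_deBruijnHBound 0 5).const_mul (4 * Real.pi * (a ! : ℝ))).mono'
    (((continuous_pow a).mul continuous_deBruijnPhiDeriv).aestronglyMeasurable.restrict)
    (ae_restrict_of_forall_mem measurableSet_Ioi hdom))

/-- `u^a Φ(u) → 0` as `u → ∞` (`|Φ| ≤ C e^{9u − πe^{4u}}`). -/
theorem tendsto_pow_mul_deBruijnPhi_atTop (a : ℕ) :
    Tendsto (fun u : ℝ => u ^ a * deBruijnPhi u) atTop (𝓝 0) := by
  set C : ℝ := ∑' n, deBruijnPhiMajorant n with hC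
  have hbd : ∀ u : ℝ, 0 ≤ u → |deBruijnPhi u| ≤ C * Real.exp (9 * u - Real.pi * Real.exp (4 * u)) :=
    fun u hu => abs_deBruijnPhi_le hu
  have hC0 : 0 ≤ C := by
    have h0 := hbd 0 le_rfl
    have he : 0 < Real.exp (9 * (0 : ℝ) - Real.pi * Real.exp (4 * 0)) := Real.exp_pos _
    nlinarith [abs_nonneg (deBruijnPhi 0)]
  have hev : ∀ᶠ u : ℝ in atTop, ‖u ^ a * deBruijnPhi u‖ ≤ (a ! : ℝ) * C * Real.exp (-u) := by
    filter_upwards [eventually_ge_atTop (0 : ℝ)] with u hu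
    rw [Real.norm_eq_abs, abs_mul, abs_of_nonneg (pow_nonneg hu a)]
    have hpow : u ^ a ≤ (a ! : ℝ) * Real.exp u := pow_le_factorial_mul_exp hu a
    have h4 : 4 * u + 1 ≤ Real.exp (4 * u) := by linarith [Real.add_one_le_exp (4 * u)]
    have hπ : 3 < Real.pi := Real.pi_gt_three
    have hexp : Real.exp u * Real.exp (9 * u - Real.pi * Real.exp (4 * u)) ≤ Real.exp (-u) := by
      rw [← Real.exp_add]
      apply Real.exp_le_exp.2
      nlinarith [Real.exp_pos (4 * u)]
    calc u ^ a * |deBruijnPhi u| ≤ ((a ! : ℝ) * Real.exp u) *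
          (C * Real.exp (9 * u - Real.pi * Real.exp (4 * u))) :=
          mul_le_mul hpow (hbd u hu) (abs_nonneg _) (by positivity)
      _ = (a ! : ℝ) * C * (Real.exp u * Real.exp (9 * u - Real.pi * Real.exp (4 * u))) := by ring
      _ ≤ (a ! : ℝ) * C * Real.exp (-u) := by gcongr
  have hlim : Tendsto (fun u : ℝ => (a ! : ℝ) * C * Real.exp (-u)) atTop (𝓝 0) := by
    simpa using (Real.tendsto_exp_neg_atTop_nhds_zero.const_mul ((a ! : ℝ) * C))
  exact squeeze_zero_norm' hev hlim

/-- **Integration by parts**: `∫₀^∞ u^a Φ′(u) du = −a·M_{a−1}` for `a ≥ 1`. -/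
theorem integral_pow_mul_deBruijnPhiDeriv (a : ℕ) (ha : 1 ≤ a) :
    ∫ u in Ioi (0 : ℝ), u ^ a * deBruijnPhiDeriv u = -((a : ℝ) * xiMoment (a - 1)) := by
  have hu : ∀ x ∈ Ioi (0 : ℝ), HasDerivAt (fun x : ℝ => x ^ a) ((a : ℝ) * x ^ (a - 1)) x :=
    fun x _ => hasDerivAt_pow a x
  have hv : ∀ x ∈ Ioi (0 : ℝ), HasDerivAt deBruijnPhi (deBruijnPhiDeriv x) x :=
    fun x _ => hasDerivAt_deBruijnPhi x
  have huv' : IntegrableOn ((fun x : ℝ => x ^ a) * deBruijnPhiDeriv) (Ioi 0) :=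
    integrableOn_pow_mul_deBruijnPhiDeriv a
  have hu'v : IntegrableOn ((fun x : ℝ => (a : ℝ) * x ^ (a - 1)) * deBruijnPhi) (Ioi 0) := by
    have h : IntegrableOn (fun x : ℝ => (a : ℝ) * (deBruijnPhi x * x ^ (a - 1))) (Ioi 0) :=
      (integrableOn_deBruijnPhi_mul_pow (a - 1)).const_mul (a : ℝ)
    refine IntegrableOn.congr_fun h (fun x _ => ?_) measurableSet_Ioi
    simp only [Pi.mul_apply]; ring
  have h_zero : Tendsto ((fun x : ℝ => x ^ a) * deBruijnPhi) (𝓝[>] 0) (𝓝 0) := by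
    have h : Tendsto (fun x : ℝ => x ^ a * deBruijnPhi x) (𝓝 0) (𝓝 ((0 : ℝ) ^ a * deBruijnPhi 0)) :=
      ((continuous_pow a).mul continuous_deBruijnPhi).tendsto 0
    rw [zero_pow (by omega), zero_mul] at h
    exact h.mono_left nhdsWithin_le_nhds
  have h_infty : Tendsto ((fun x : ℝ => x ^ a) * deBruijnPhi) atTop (𝓝 0) :=
    tendsto_pow_mul_deBruijnPhi_atTop a
  rw [integral_Ioi_mul_deriv_eq_deriv_mul hu hv huv' hu'v h_zero h_infty, sub_zero, zero_sub,
    xiMoment, ← integral_const_mul]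
  congr 1
  refine setIntegral_congr_fun measurableSet_Ioi fun x _ => ?_
  ring

/-- **Strict Turán inequality of the moments from the monotonicity of `−Φ′(u)/(uΦ(u))`** (Csordas–Norfolk–Varga's
criterion, here via Chebyshev's covariance inequality with the test functions `u²` and `g(u) = −Φ′(u)/(uΦ(u))`
against the law `u^{2k+2}Φ(u)du`; strictness from the tree's `strictMonoOn_phiNegLogDeriv_div` on `[1, ∞)`):
`(2k+1)·M_{2k}·M_{2k+4} < (2k+3)·M_{2k+2}²`. -/
theorem xiMoment_turan_strict_of_monotoneOn
    (hmono : MonotoneOn (fun u : ℝ => -deBruijnPhiDeriv u / (u * deBruijnPhi u)) (Ioi 0)) (k : ℕ) :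
    (2 * (k : ℝ) + 1) * xiMoment (2 * k) * xiMoment (2 * k + 4) <
      (2 * (k : ℝ) + 3) * xiMoment (2 * k + 2) ^ 2 := by
  set g : ℝ → ℝ := fun u => -deBruijnPhiDeriv u / (u * deBruijnPhi u) with hg
  have hA := xiMoment_pos (2 * k + 2)
  have hB := xiMoment_pos (2 * k + 4)
  have hZ := xiMoment_pos (2 * k)
  set m : ℝ := Real.sqrt (xiMoment (2 * k + 4) / xiMoment (2 * k + 2)) with hm
  have hm0 : 0 < m := Real.sqrt_pos.2 (div_pos hB hA)
  have hm2 : m ^ 2 = xiMoment (2 * k + 4) / xiMoment (2 * k + 2) := Real.sq_sqrt (div_pos hB hA).le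
  have hgL : ∀ u, g u = phiNegLogDeriv u / u := fun u => by
    simp only [hg, phiNegLogDeriv]; rw [div_div, mul_comm]
  -- strict growth of `g` beyond `max m 1`
  have hg_gt : ∀ u, max m 1 < u → g m < g u := by
    intro u hu
    have hu1 : 1 < u := lt_of_le_of_lt (le_max_right _ _) hu
    have hum : m < u := lt_of_le_of_lt (le_max_left _ _) hu
    rcases le_or_gt 1 m with h1m | hm1
    · have h := strictMonoOn_phiNegLogDeriv_div (show m ∈ Ici (1 : ℝ) from h1m)
        (show u ∈ Ici (1 : ℝ) from hu1.le) hum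
      rw [hgL, hgL]; exact h
    · have h1 : g m ≤ g 1 := hmono (show m ∈ Ioi (0 : ℝ) from hm0) (show (1 : ℝ) ∈ Ioi 0 from Set.mem_Ioi.2 one_pos) hm1.le
      have h2 := strictMonoOn_phiNegLogDeriv_div (show (1 : ℝ) ∈ Ici 1 from Set.mem_Ici.2 le_rfl)
        (show u ∈ Ici (1 : ℝ) from hu1.le) hu1
      have h2' : g 1 < g u := by rw [hgL, hgL]; exact h2
      exact lt_of_le_of_lt h1 h2'
  set F : ℝ → ℝ := fun u => (u ^ 2 - m ^ 2) * (g u - g m) * (deBruijnPhi u * u ^ (2 * k + 2)) with hF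
  have hF_nonneg : ∀ u ∈ Ioi (0 : ℝ), 0 ≤ F u := by
    intro u hu
    have hu0 : 0 < u := hu
    have hw : 0 ≤ deBruijnPhi u * u ^ (2 * k + 2) :=
      (mul_pos (deBruijnPhi_pos_of_nonneg hu0.le) (pow_pos hu0 _)).le
    have hprod : 0 ≤ (u ^ 2 - m ^ 2) * (g u - g m) := by
      rcases le_total u m with hle | hge
      · have h1 : u ^ 2 - m ^ 2 ≤ 0 := by nlinarith
        have h2 : g u - g m ≤ 0 := by
          linarith [hmono (show u ∈ Ioi (0 : ℝ) from hu0) (show m ∈ Ioi (0 : ℝ) from hm0) hle]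
        exact mul_nonneg_of_nonpos_of_nonpos h1 h2
      · have h1 : 0 ≤ u ^ 2 - m ^ 2 := by nlinarith
        have h2 : 0 ≤ g u - g m := by
          linarith [hmono (show m ∈ Ioi (0 : ℝ) from hm0) (show u ∈ Ioi (0 : ℝ) from hu0) hge]
        exact mul_nonneg h1 h2
    exact mul_nonneg hprod hw
  have hF_pos : ∀ u, max m 1 < u → 0 < F u := by
    intro u hu
    have hum : m < u := lt_of_le_of_lt (le_max_left _ _) hu
    have hu0 : 0 < u := hm0.trans hum
    have h1 : 0 < u ^ 2 - m ^ 2 := by nlinarith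
    have h2 : 0 < g u - g m := by linarith [hg_gt u hu]
    exact mul_pos (mul_pos h1 h2) (mul_pos (deBruijnPhi_pos_of_nonneg hu0.le) (pow_pos hu0 _))
  -- the integrand as a combination of integrable pieces
  have hI1 : IntegrableOn (fun u : ℝ => -(u ^ (2 * k + 3) * deBruijnPhiDeriv u)) (Ioi 0) :=
    (integrableOn_pow_mul_deBruijnPhiDeriv (2 * k + 3)).neg
  have hI2 : IntegrableOn (fun u : ℝ => m ^ 2 * (u ^ (2 * k + 1) * deBruijnPhiDeriv u)) (Ioi 0) :=
    (integrableOn_pow_mul_deBruijnPhiDeriv (2 * k + 1)).const_mul _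
  have hI3 : IntegrableOn (fun u : ℝ => g m * (deBruijnPhi u * u ^ (2 * k + 4))) (Ioi 0) :=
    (integrableOn_deBruijnPhi_mul_pow (2 * k + 4)).const_mul _
  have hI4 : IntegrableOn (fun u : ℝ => g m * m ^ 2 * (deBruijnPhi u * u ^ (2 * k + 2))) (Ioi 0) :=
    (integrableOn_deBruijnPhi_mul_pow (2 * k + 2)).const_mul _
  have hFeq : EqOn F (fun u => -(u ^ (2 * k + 3) * deBruijnPhiDeriv u) +
      m ^ 2 * (u ^ (2 * k + 1) * deBruijnPhiDeriv u) - g m * (deBruijnPhi u * u ^ (2 * k + 4)) +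
      g m * m ^ 2 * (deBruijnPhi u * u ^ (2 * k + 2))) (Ioi 0) := by
    intro u hu
    have hu0 : 0 < u := hu
    have hΦ : deBruijnPhi u ≠ 0 := (deBruijnPhi_pos_of_nonneg hu0.le).ne'
    have hu' : u ≠ 0 := hu0.ne'
    simp only [hF, hg]
    field_simp
    ring
  have hFint : IntegrableOn F (Ioi 0) :=
    IntegrableOn.congr_fun (((hI1.add hI2).sub hI3).add hI4) hFeq.symm measurableSet_Ioi
  have hval1 := integral_pow_mul_deBruijnPhiDeriv (2 * k + 3) (by omega)
  have hval2 := integral_pow_mul_deBruijnPhiDeriv (2 * k + 1) (by omega)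
  rw [show 2 * k + 3 - 1 = 2 * k + 2 by omega] at hval1
  rw [show 2 * k + 1 - 1 = 2 * k by omega] at hval2
  have hFval : ∫ u in Ioi (0 : ℝ), F u = (2 * (k : ℝ) + 3) * xiMoment (2 * k + 2) -
      m ^ 2 * ((2 * (k : ℝ) + 1) * xiMoment (2 * k)) := by
    have hI12 : IntegrableOn (fun u : ℝ => -(u ^ (2 * k + 3) * deBruijnPhiDeriv u) +
        m ^ 2 * (u ^ (2 * k + 1) * deBruijnPhiDeriv u)) (Ioi 0) := hI1.add hI2
    have hI123 : IntegrableOn (fun u : ℝ => -(u ^ (2 * k + 3) * deBruijnPhiDeriv u) +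
        m ^ 2 * (u ^ (2 * k + 1) * deBruijnPhiDeriv u) - g m * (deBruijnPhi u * u ^ (2 * k + 4))) (Ioi 0) :=
      hI12.sub hI3
    rw [setIntegral_congr_fun measurableSet_Ioi hFeq, integral_add hI123 hI4,
      integral_sub hI12 hI3, integral_add hI1 hI2, integral_neg, integral_const_mul,
      integral_const_mul, integral_const_mul, hval1, hval2]
    have e3 : ∫ u in Ioi (0 : ℝ), deBruijnPhi u * u ^ (2 * k + 4) = xiMoment (2 * k + 4) := rfl
    have e4 : ∫ u in Ioi (0 : ℝ), deBruijnPhi u * u ^ (2 * k + 2) = xiMoment (2 * k + 2) := rfl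
    rw [e3, e4, hm2]
    push_cast
    field_simp
    ring
  -- positivity of the integral
  have hpos : 0 < ∫ u in Ioi (0 : ℝ), F u := by
    rw [setIntegral_pos_iff_support_of_nonneg_ae (ae_restrict_of_forall_mem measurableSet_Ioi hF_nonneg) hFint]
    have hsub : Ioi (max m 1) ⊆ Function.support F ∩ Ioi 0 := fun u hu =>
      ⟨(hF_pos u hu).ne', hm0.trans (lt_of_le_of_lt (le_max_left _ _) hu)⟩
    refine lt_of_lt_of_le ?_ (measure_mono hsub)
    rw [Real.volume_Ioi]; exact ENNReal.zero_lt_top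
  rw [hFval, hm2] at hpos
  -- (2k+3)A − (B/A)(2k+1)Z > 0  ⟹  (2k+1) Z B < (2k+3) A²
  have key : (xiMoment (2 * k + 4) / xiMoment (2 * k + 2)) * ((2 * (k : ℝ) + 1) * xiMoment (2 * k)) <
      (2 * (k : ℝ) + 3) * xiMoment (2 * k + 2) := by linarith
  rw [div_mul_eq_mul_div, div_lt_iff₀ hA] at key
  nlinarith [key]

/-- The strict Turán inequalities `γ(k)γ(k+2) < γ(k+1)²` of the Taylor coefficients of `ξ`, from the monotonicity
of `−Φ′/(uΦ)` (`γ(k) = 64·4^k·k!/(2k)!·M_{2k}` turns them into `(2k+1)M_{2k}M_{2k+4} < (2k+3)M_{2k+2}²`). -/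
theorem xiTaylorCoeff_turan_strict_of_monotoneOn
    (hmono : MonotoneOn (fun u : ℝ => -deBruijnPhiDeriv u / (u * deBruijnPhi u)) (Ioi 0)) (k : ℕ) :
    xiTaylorCoeff k * xiTaylorCoeff (k + 2) < xiTaylorCoeff (k + 1) ^ 2 := by
  have h := xiMoment_turan_strict_of_monotoneOn hmono k
  have hk0 : (0 : ℝ) < k ! := by positivity
  have h2k : (0 : ℝ) < (2 * k)! := by positivity
  have f1 : (((k + 1)! : ℕ) : ℝ) = ((k : ℝ) + 1) * (k ! : ℝ) := by
    rw [Nat.factorial_succ]; push_cast; ring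
  have f2 : (((k + 2)! : ℕ) : ℝ) = ((k : ℝ) + 2) * ((k : ℝ) + 1) * (k ! : ℝ) := by
    rw [show k + 2 = (k + 1) + 1 from rfl, Nat.factorial_succ, Nat.factorial_succ]; push_cast; ring
  have f3 : (((2 * (k + 1))! : ℕ) : ℝ) = (2 * (k : ℝ) + 2) * (2 * (k : ℝ) + 1) * ((2 * k)! : ℝ) := by
    rw [show 2 * (k + 1) = (2 * k + 1) + 1 by ring, Nat.factorial_succ, Nat.factorial_succ]; push_cast; ring
  have f4 : (((2 * (k + 2))! : ℕ) : ℝ) =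
      (2 * (k : ℝ) + 4) * (2 * (k : ℝ) + 3) * (2 * (k : ℝ) + 2) * (2 * (k : ℝ) + 1) * ((2 * k)! : ℝ) := by
    rw [show 2 * (k + 2) = (2 * k + 3) + 1 by ring, Nat.factorial_succ, Nat.factorial_succ,
      show 2 * k + 2 = (2 * k + 1) + 1 by ring, Nat.factorial_succ, Nat.factorial_succ]; push_cast; ring
  set K : ℝ := (32 * 4 ^ (k + 1) * (k ! : ℝ) / ((2 * k)! : ℝ)) ^ 2 / ((2 * (k : ℝ) + 1) ^ 2 * (2 * (k : ℝ) + 3))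
    with hK
  have hKpos : 0 < K := by positivity
  have e1 : xiTaylorCoeff k * xiTaylorCoeff (k + 2) =
      K * ((2 * (k : ℝ) + 1) * xiMoment (2 * k) * xiMoment (2 * k + 4)) := by
    rw [xiTaylorCoeff_eq_xiMoment k, xiTaylorCoeff_eq_xiMoment (k + 2), f2, f4,
      show 2 * (k + 2) = 2 * k + 4 by ring, hK]
    field_simp
    ring
  have e2 : xiTaylorCoeff (k + 1) ^ 2 = K * ((2 * (k : ℝ) + 3) * xiMoment (2 * k + 2) ^ 2) := by
    rw [xiTaylorCoeff_eq_xiMoment (k + 1), f1, f3, show 2 * (k + 1) = 2 * k + 2 by ring, hK]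
    field_simp
    ring
  rw [e1, e2]
  exact mul_lt_mul_of_pos_left h hKpos

/-- **S-T5 from Csordas–Norfolk–Varga's monotonicity**: `Δ(M)² > 0` for every `M ≥ 2`. -/
theorem xiDeltaSqPos_of_monotoneOn
    (hmono : MonotoneOn (fun u : ℝ => -deBruijnPhiDeriv u / (u * deBruijnPhi u)) (Ioi 0)) :
    XiDeltaSqPos := by
  intro M hM
  obtain ⟨k, rfl⟩ : ∃ k, M = k + 2 := ⟨M - 2, by omega⟩
  have ht := xiTaylorCoeff_turan_strict_of_monotoneOn hmono k
  have hpos : 0 < xiTaylorCoeff (k + 1) := xiTaylorCoeff_pos_holds (k + 1)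
  unfold gorttwDeltaSq windowSeqDown
  rw [show k + 2 - 2 = k by omega, show k + 2 - 1 = k + 1 by omega, show (2 : ℕ) - 1 = 1 from rfl, pow_one]
  have hlt : xiTaylorCoeff k * xiTaylorCoeff (k + 2) / xiTaylorCoeff (k + 1) ^ 2 < 1 :=
    (div_lt_one (pow_pos hpos 2)).2 ht
  linarith

/-- **Conditional closer of the route's support item `XiDeltaSqPos` (S-T5)**: the strict Turán inequalities of
`ξ`'s Taylor data — `Δ(M)² > 0` for all `M ≥ 2` — follow in the kernel from the single published lemma
`DeBruijnPhiLogConcaveSqrt` (Csordas–Norfolk–Varga 1986), zero-free and height-free. -/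
theorem xiDeltaSqPos_of_logConcaveSqrt (h : Literature.NumberTheory.LFunctions.DeBruijnPhiLogConcaveSqrt) : XiDeltaSqPos :=
  xiDeltaSqPos_of_monotoneOn h

/-- **Strict monotonicity of `L(u)/u` on `[1/4, ∞)` (unconditional)** — the tree's argument for `[1, ∞)`
(`strictMonoOn_phiNegLogDeriv_div`) verbatim: the derivative `(uV(u) − L(u))/u²` is positive because
`uV(u) > 16πu·e^{4u} ≥ 4πe^{4u} > 4πe^{4u} − 9 ≥ L(u)` once `u ≥ 1/4` (Coffey–Csordas' quantitative log-concavity and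
the upper envelope of `L`). -/
theorem strictMonoOn_phiNegLogDeriv_div_quarter :
    StrictMonoOn (fun a : ℝ => phiNegLogDeriv a / a) (Ici (1 / 4)) := by
  have hder : ∀ a : ℝ, 0 < a → HasDerivAt (fun a : ℝ => phiNegLogDeriv a / a)
      ((phiNegLogDeriv₂ a * a - phiNegLogDeriv a * 1) / a ^ 2) a := fun a ha =>
    (hasDerivAt_phiNegLogDeriv a).div (hasDerivAt_id a) ha.ne'
  refine strictMonoOn_of_deriv_pos (convex_Ici (1 / 4))
    (fun a ha => (hder a (lt_of_lt_of_le (by norm_num) ha)).continuousAt.continuousWithinAt) ?_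
  intro a ha
  rw [interior_Ici] at ha
  have ha4 : 1 / 4 < a := ha
  have ha0 : 0 < a := lt_trans (by norm_num) ha4
  rw [(hder a ha0).deriv]
  apply div_pos _ (pow_pos ha0 2)
  have hV := phiNegLogDeriv₂_gt a
  rw [abs_of_pos ha0] at hV
  have hL : phiNegLogDeriv a ≤ 4 * Real.pi * Real.exp (4 * a) - 9 := by
    unfold phiNegLogDeriv; exact neg_deBruijnPhiDeriv_div_le ha0.le
  have hE : 0 ≤ 16 * Real.pi * Real.exp (4 * a) := by positivity
  have h1 : 16 * Real.pi * Real.exp (4 * a) * (1 / 4) ≤ 16 * Real.pi * Real.exp (4 * a) * a :=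
    mul_le_mul_of_nonneg_left ha4.le hE
  have h2 : 16 * Real.pi * Real.exp (4 * a) * a < phiNegLogDeriv₂ a * a := mul_lt_mul_of_pos_right hV ha0
  linarith

/-- **S-T5 from the monotonicity on the window `(0, 1/4]` alone**: the large-`u` half is the previous theorem, and
monotone pieces sharing the endpoint `1/4` glue (`MonotoneOn.union_right`). This is the sharpest form of what remains
of item `XiDeltaSqPos`: `u ↦ −Φ′(u)/(uΦ(u))` non-decreasing on `(0, 1/4]` (a statement about `Φ` near `0`). -/
theorem xiDeltaSqPos_of_monotoneOn_small
    (hsmall : MonotoneOn (fun u : ℝ => -deBruijnPhiDeriv u / (u * deBruijnPhi u)) (Ioc 0 (1 / 4))) :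
    XiDeltaSqPos := by
  apply xiDeltaSqPos_of_monotoneOn
  have hgL : (fun u : ℝ => -deBruijnPhiDeriv u / (u * deBruijnPhi u)) = fun u => phiNegLogDeriv u / u := by
    funext u; simp only [phiNegLogDeriv]; rw [div_div, mul_comm]
  have hlarge : MonotoneOn (fun u : ℝ => -deBruijnPhiDeriv u / (u * deBruijnPhi u)) (Ici (1 / 4)) := by
    rw [hgL]; exact strictMonoOn_phiNegLogDeriv_div_quarter.monotoneOn
  have hunion : Ioc (0 : ℝ) (1 / 4) ∪ Ici (1 / 4) = Ioi 0 := by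
    ext u; simp only [mem_union, mem_Ioc, mem_Ici, mem_Ioi]; constructor
    · rintro (⟨h, _⟩ | h)
      · exact h
      · linarith
    · intro h; by_cases h4 : u ≤ 1 / 4
      · exact Or.inl ⟨h, h4⟩
      · exact Or.inr (le_of_lt (not_le.mp h4))
  rw [← hunion]
  exact MonotoneOn.union_right hsmall hlarge ⟨⟨by norm_num, le_rfl⟩, fun x hx => hx.2⟩
    ⟨Set.mem_Ici.2 le_rfl, fun x hx => hx⟩

/-- **S-T5 from the monotonicity of `V = −(log Φ)″` on `[0, 1/4]`** — the cleanest form of what remains: if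
`V = phiNegLogDeriv₂` is non-decreasing on `[0, 1/4]` then `L = −Φ′/Φ` (`L(0) = 0`, `L′ = V`) is convex there, so
the chord slopes `L(u)/u` increase on `(0, 1/4]`, and `xiDeltaSqPos_of_monotoneOn_small` applies.  (Numerically
`V(u) ≈ 75.0 + 1.1·10³u²` on `[0, 1/4]`; a kernel proof needs `V′ = −(log Φ)‴ ≥ 0`, i.e. `Φ‴`, from the theta series.) -/
theorem xiDeltaSqPos_of_monotoneOn_logConcavity
    (hV : MonotoneOn phiNegLogDeriv₂ (Icc 0 (1 / 4))) : XiDeltaSqPos := by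
  apply xiDeltaSqPos_of_monotoneOn_small
  have hconv : ConvexOn ℝ (Icc (0 : ℝ) (1 / 4)) phiNegLogDeriv := by
    refine MonotoneOn.convexOn_of_deriv (convex_Icc 0 (1 / 4)) continuous_phiNegLogDeriv.continuousOn
      (fun x _ => (hasDerivAt_phiNegLogDeriv x).differentiableAt.differentiableWithinAt) ?_
    rw [deriv_phiNegLogDeriv, interior_Icc]
    exact hV.mono Ioo_subset_Icc_self
  intro s hs t ht hst
  have hs0 : 0 < s := hs.1
  have ht0 : 0 < t := ht.1
  have hgs : -deBruijnPhiDeriv s / (s * deBruijnPhi s) = phiNegLogDeriv s / s := by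
    simp only [phiNegLogDeriv]; rw [div_div, mul_comm]
  have hgt : -deBruijnPhiDeriv t / (t * deBruijnPhi t) = phiNegLogDeriv t / t := by
    simp only [phiNegLogDeriv]; rw [div_div, mul_comm]
  show -deBruijnPhiDeriv s / (s * deBruijnPhi s) ≤ -deBruijnPhiDeriv t / (t * deBruijnPhi t)
  rw [hgs, hgt]
  rcases eq_or_lt_of_le hst with rfl | hlt
  · exact le_rfl
  have hslope := hconv.slope_mono_adjacent (x := 0) (y := s) (z := t)
    (Set.mem_Icc.2 ⟨le_rfl, by norm_num⟩) (Set.mem_Icc.2 ⟨ht0.le, ht.2⟩) hs0 hlt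
  rw [phiNegLogDeriv_zero, sub_zero, sub_zero] at hslope
  rw [div_le_div_iff₀ hs0 ht0]
  have hts : 0 < t - s := by linarith
  rw [div_le_div_iff₀ hs0 hts] at hslope
  nlinarith [hslope]

end Summit.RiemannHypothesis.RiemannHypothesis.Theorems.JensenPolynomials

end
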